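import Summits.CriticalPhenomena.Ising3DConformalLimit.Theses.PlantedPinning

/-!
# Birth skeleton for crux `GaussianPinningSaturation` (stmt-CriticalPhenomena-8452)

Route `PlantedPinning` (route-CriticalPhenomena-PlantedPinning), sub-problem `Ising3DConformalLimit`,
crux r3 `Summit.CriticalPhenomena.Ising3DConformalLimit.Theses.PlantedPinning.GaussianPinningSaturation`:
a non-degenerate, Möbius-covariant pointwise scaling limit of `criticalCorr 3` with `U₄ ≡ 0` off
coincidences forces SATURATION of the planted-pinning efficiency,
`liminf_{p→0⁺} liminf_{L→∞} e_L(⌈p·|Λ_L|⌉) ≥ 1`, where `e_L(k) = k·v_{L,k}/((n+1)(n−k+1))`,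
`n = |Λ_L|`, `Λ_L = box 3 L`, and `v_{L,k}` is the conditional variance of the total spin
`M_L = Σ_{x∈Λ_L} σ_x` given a uniformly random `k`-subset of spins pinned to values drawn from the
critical `+` state `μ⁺_{Λ_L;β_c(3),0}` itself (planted pins; conditional law =
`isingMeasure (zdGraph 3) (Λ_L ∖ P) β_c 0 (.fixed σ*)`).

## The line: LINEAR-BENCHMARK SPLIT ("Gaussian pinning = linear regression; Gaussian LIMIT = asymptotically linear regression")

For any square-integrable vector the planted conditional variance splits EXACTLY (law of total
variance + `L²`-orthogonality of the regression onto the affine span of the pinned spins):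

  `E⁺[Var(M | σ_P)] = R_L(P) − N_L(P)`,

* `R_L(P) = Var⁺(M) − C_{M,P} (G_{PP})⁻¹ C_{P,M}` — the LINEAR (Gaussian) residual, a functional of the
  truncated two-point function `G(x,y) = ⟨σ_xσ_y⟩⁺_L − ⟨σ_x⟩⁺_L⟨σ_y⟩⁺_L` ONLY (value-blind: it does
  not see the pinned values) — `linResidual` below; for a Gaussian vector with covariance `G` it IS
  the conditional variance, so `e^{lin}` is literally the pinning efficiency of "the Gaussian field
  with the Ising covariance";
* `N_L(P) = E⁺[(E[M | σ_P] − Lin_P(σ_P))²] ≥ 0` — the squared `L²`-norm of the NONLINEAR part of the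
  planted regression `σ_P ↦ E[M | σ_P]` (`regressionGap` below).

Hence `e_L(k) = e^{lin}_L(k) − e^{gap}_L(k)` (same normalisation `k/((n+1)(n−k+1))`, averaged over
uniform `k`-subsets), and the crux follows from

* STUB A `stub_varianceSplit` (identity level, provable now, M): the split above for the critical
  finite-volume `+` state, for every `P ⊆ Λ_L` — finite-volume DLR consistency
  (`μ⁺_Λ( · | σ_P = τ_P) = isingMeasure (Λ∖P) β 0 (.fixed (glue Λ τ plus))`, the tree's
  `IsingConsistency` lemmas already used for the landed ceiling `pinningEfficiencyLeOne_proof`), the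
  tower property, and the normal equations of the affine `L²(μ⁺_Λ)`-projection onto
  `span{1, σ_a : a ∈ P}` (needs `G_{PP}` positive definite: `μ⁺_Λ` charges every pattern on `Λ`).
* STUB B `stub_twoPointSaturation` (two-point level, L–XL): under the TWO-POINT part of the crux
  hypotheses (non-degenerate Möbius-covariant pointwise limit ⇒ `⟨σ₀σ_x⟩_{β_c}` regularly varying of
  index `−2Δ`; NO Gaussianity assumed), the linear efficiency saturates:
  `liminf_{p→0⁺} liminf_L e^{lin}_L(⌈pn⌉) ≥ 1`. This is the route's "lattice-GFF benchmark"
  (`p·E₀[τ_P] → G(0,0)`: annealed Bernoulli traps, range LLN) transplanted from the Green function to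
  the critical Ising covariance kernel: random Schur complements of a regularly varying, entrywise
  non-negative (Griffiths) positive-definite kernel at pin density `p → 0` — the three Riccati
  slacks (residual single-spin variance `(G/G_{PP})_{zz} → 1`, Cauchy–Schwarz homogeneity of the
  linear conditional susceptibility `χ_P(z) = Σ_y (G/G_{PP})_{zy}` over unpinned `z`, Jensen over `P`)
  all vanish because `≍ p·L*(p)³ → ∞` pins sit inside one screening ball. It is a statement about
  the two-point function alone and is MC-testable (kill: linear efficiency plateau `< 1`).
* STUB C `stub_gaussianLinearisesRegression` (LOAD-BEARING, XL, the crux's own mechanism): under the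
  FULL crux hypotheses (`U₄ ≡ 0` off coincidences included), the nonlinear regression efficiency
  vanishes, `limsup_{p→0⁺} limsup_L e^{gap}_L(⌈pn⌉) = 0`: a Gaussian scaling limit makes the planted
  regression of the total spin on a density-`p` sample of itself asymptotically LINEAR at the
  screening scale `L*(p) → ∞` (the "conditional CLT for the pinned field" named in the route's
  two-layer plan; planted analogue of `stub_regressionLinearises` of line
  `GaussianLimitNotScreened/single-layer-linear-regression`). Why it might fail = the crux's why:
  pins are lattice `±1` constraints and `U₄ ≡ 0` of macroscopic `n`-point limits must control
  `E[σ_z | σ_P]` for `z` at mesoscopic distance from `≍ p^{-1/2}` pins.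

Composition `GaussianPinningSaturation_of` (real proof, no `sorry`): sum STUB A over
`P ∈ powersetCard k`, push the difference through the average and the (linear) normalisation
(`plantedEff = linEff − gapEff`), then `ε/2 + ε/2` from STUBS B and C at `p < min p₁ p₂`,
`L ≥ max L₁ L₂`; the crux is reached BY NAME through the definitional unfolding
`eff L k ≡ plantedEff L k` of its `let`-tower.

Hardest stub: C. Disproof used: none (no `Cruxes/GaussianPinningSaturation/Disproof.lean` exists at
registration, 2026-08-17). Dead lines: none recorded for this crux.
Registrar: planner-skel-stmt-CriticalPhenomena-8452-0 (skeleton-register, one-shot), 2026-08-17.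
-/

open scoped BigOperators Classical
open Finset MeasureTheory
open Literature.Probability.LatticeModels

noncomputable section

namespace Summit.CriticalPhenomena.Ising3DConformalLimit.Cruxes.GaussianPinningSaturation.Birth

/-! ### Vocabulary (all finite-volume, all over existing `Literature.Probability.LatticeModels` declarations)

`d = 3`, `Λ_L = box 3 L`, `β = criticalBeta 3`, `h = 0`, `+` boundary condition. The first block
mirrors the `let`-tower of the crux (`M`, `cvar`, `pvar`, `eff`) definitionally. -/

/-- The critical finite-volume `+` expectation `⟨f⟩⁺_{Λ_L;β_c(3),0}`. -/
def plusE (L : ℕ) (f : SpinConfig (Site 3) → ℝ) : ℝ :=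
  isingExpect (zdGraph 3) (box 3 L) (criticalBeta 3) 0 .plus f

/-- Total spin of the box, `M_L(σ) = Σ_{x ∈ Λ_L} σ_x` (the crux's `M L`). -/
def totalSpin (L : ℕ) (σ : SpinConfig (Site 3)) : ℝ :=
  ∑ x ∈ box 3 L, spinAt x σ

/-- Plus-state probability `w(τ)/Z` of the pattern `τ` on `Λ_L` (the planted law of the pin values). -/
def plusProb (L : ℕ) (τ : ↥(box 3 L) → ℤˣ) : ℝ :=
  isingWeight (zdGraph 3) (box 3 L) (criticalBeta 3) 0 .plus τ /
    isingPartitionFunction (zdGraph 3) (box 3 L) (criticalBeta 3) 0 .plus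

/-- Conditional mean of `M_L` given the pins `P` at values `η`: the law given `σ_P = η_P` (and `+`
outside `Λ_L`) is `isingMeasure (zdGraph 3) (Λ_L ∖ P) β_c 0 (.fixed η)`. -/
def pinnedMean (L : ℕ) (P : Finset (Site 3)) (η : SpinConfig (Site 3)) : ℝ :=
  isingExpect (zdGraph 3) (box 3 L \ P) (criticalBeta 3) 0 (.fixed η) (totalSpin L)

/-- Conditional variance of `M_L` given the pins `P` at values `η` (the crux's `cvar L P η`). -/
def pinnedVar (L : ℕ) (P : Finset (Site 3)) (η : SpinConfig (Site 3)) : ℝ :=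
  isingExpect (zdGraph 3) (box 3 L \ P) (criticalBeta 3) 0 (.fixed η) (fun σ => totalSpin L σ ^ 2)
    - isingExpect (zdGraph 3) (box 3 L \ P) (criticalBeta 3) 0 (.fixed η) (totalSpin L) ^ 2

/-- Planted conditional variance `v_{L,k}`: `pinnedVar` averaged over uniform `k`-subsets `P ⊆ Λ_L`
and over pin values `σ* ∼ μ⁺_{Λ_L}` (the crux's `pvar L k`). -/
def plantedVar (L k : ℕ) : ℝ :=
  (∑ P ∈ (box 3 L).powersetCard k, ∑ τ : ↥(box 3 L) → ℤˣ,
      plusProb L τ * pinnedVar L P (glue (box 3 L) τ .plus)) / ((box 3 L).card.choose k : ℝ)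

/-- The pinning-efficiency normalisation `e = k·v/((n+1)(n−k+1))`, `n = |Λ_L|` (linear in `v`). -/
def effOf (L k : ℕ) (v : ℝ) : ℝ :=
  (k : ℝ) * v / ((((box 3 L).card : ℝ) + 1) * (((box 3 L).card : ℝ) - k + 1))

/-- The planted-pinning efficiency `e_L(k)` (the crux's `eff L k`, definitionally). -/
def plantedEff (L k : ℕ) : ℝ := effOf L k (plantedVar L k)

/-! ### The linear (Gaussian) benchmark built from the truncated two-point function only -/

/-- Truncated two-point function (covariance matrix) of the critical `+` state in `Λ_L`,
`G_L(x,y) = ⟨σ_xσ_y⟩⁺_L − ⟨σ_x⟩⁺_L ⟨σ_y⟩⁺_L`. -/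
def cov (L : ℕ) (x y : Site 3) : ℝ :=
  plusE L (fun σ => spinAt x σ * spinAt y σ) - plusE L (spinAt x) * plusE L (spinAt y)

/-- Covariance matrix of the pinned spins, `G_{PP}`. -/
def covMat (L : ℕ) (P : Finset (Site 3)) : Matrix ↥P ↥P ℝ :=
  Matrix.of fun a b => cov L a.1 b.1

/-- `Cov⁺_L(M_L, σ_a) = Σ_{x ∈ Λ_L} G_L(x,a)`. -/
def covTot (L : ℕ) (a : Site 3) : ℝ :=
  ∑ x ∈ box 3 L, cov L x a

/-- LINEAR residual variance of `M_L` given `σ_P` (Schur complement; value-blind):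
`R_L(P) = Var⁺_L(M_L) − C_{M,P} (G_{PP})⁻¹ C_{P,M}`. For a Gaussian vector with covariance `G_L`
this is the conditional variance given the pins. (`Matrix.inv` junk is never met for `P ⊆ Λ_L`:
`G_{PP}` is positive definite.) -/
def linResidual (L : ℕ) (P : Finset (Site 3)) : ℝ :=
  (∑ x ∈ box 3 L, ∑ y ∈ box 3 L, cov L x y)
    - ∑ a : ↥P, ∑ b : ↥P, covTot L a.1 * (covMat L P)⁻¹ a b * covTot L b.1

/-- Best LINEAR (affine) predictor of `M_L` from the pinned spins, evaluated at `η`: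
`Lin_P(η) = ⟨M_L⟩⁺_L + C_{M,P} (G_{PP})⁻¹ (η_P − ⟨σ_P⟩⁺_L)`. -/
def linPred (L : ℕ) (P : Finset (Site 3)) (η : SpinConfig (Site 3)) : ℝ :=
  plusE L (totalSpin L)
    + ∑ a : ↥P, ∑ b : ↥P,
        covTot L a.1 * (covMat L P)⁻¹ a b * (spinAt b.1 η - plusE L (spinAt b.1))

/-- NONLINEAR regression gap `N_L(P) = E⁺[(E[M_L | σ_P] − Lin_P(σ_P))²] ≥ 0`: squared `L²(μ⁺_L)`-norm
of the nonlinear part of the planted regression. -/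
def regressionGap (L : ℕ) (P : Finset (Site 3)) : ℝ :=
  ∑ τ : ↥(box 3 L) → ℤˣ, plusProb L τ *
    (pinnedMean L P (glue (box 3 L) τ .plus) - linPred L P (glue (box 3 L) τ .plus)) ^ 2

/-- Linear residual averaged over uniform `k`-subsets. -/
def linVar (L k : ℕ) : ℝ :=
  (∑ P ∈ (box 3 L).powersetCard k, linResidual L P) / ((box 3 L).card.choose k : ℝ)

/-- Regression gap averaged over uniform `k`-subsets. -/
def gapVar (L k : ℕ) : ℝ :=
  (∑ P ∈ (box 3 L).powersetCard k, regressionGap L P) / ((box 3 L).card.choose k : ℝ)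

/-- LINEAR pinning efficiency `e^{lin}_L(k)` (pinning efficiency of the Gaussian vector with the
Ising covariance; `≤ 1` by the Gaussian pinning lemma). -/
def linEff (L k : ℕ) : ℝ := effOf L k (linVar L k)

/-- Regression-gap efficiency `e^{gap}_L(k) ≥ 0`; `e = e^{lin} − e^{gap}`. -/
def gapEff (L k : ℕ) : ℝ := effOf L k (gapVar L k)

/-! ### The three stub STATEMENTS (named; the registered stubs below spell them out verbatim) -/

/-- STUB A statement (identity level): planted conditional variance = linear residual − regression gap. -/
def VarianceSplit : Prop :=
  ∀ (L : ℕ) (P : Finset (Site 3)), P ⊆ box 3 L →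
    ∑ τ : ↥(box 3 L) → ℤˣ, plusProb L τ * pinnedVar L P (glue (box 3 L) τ .plus)
      = linResidual L P - regressionGap L P

/-- STUB B statement (two-point level, no Gaussianity): the LINEAR efficiency saturates. -/
def TwoPointSaturation : Prop :=
  ∀ (ρ : ℝ → ℝ) (Δ : ℝ) (S : CorrFamily 3), (∀ δ ∈ Set.Ioc (0:ℝ) 1, 0 < ρ δ) → 0 < Δ →
    HasPointwiseScalingLimit (criticalCorr 3) ρ S → IsNondegenerateTwoPoint S →
    IsMoebiusCovariant Δ S →
    ∀ ε : ℝ, 0 < ε → ∃ p₀ : ℝ, 0 < p₀ ∧ ∀ p : ℝ, 0 < p → p < p₀ → ∃ L₀ : ℕ, ∀ L ≥ L₀,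
      1 - ε ≤ linEff L ⌈p * ((box 3 L).card : ℝ)⌉₊

/-- STUB C statement (load-bearing): a Gaussian (`U₄ ≡ 0`) non-degenerate Möbius limit linearises
the planted regression — the gap efficiency vanishes. -/
def GaussianLinearisesRegression : Prop :=
  ∀ (ρ : ℝ → ℝ) (Δ : ℝ) (S : CorrFamily 3), (∀ δ ∈ Set.Ioc (0:ℝ) 1, 0 < ρ δ) → 0 < Δ →
    HasPointwiseScalingLimit (criticalCorr 3) ρ S → IsNondegenerateTwoPoint S →
    IsMoebiusCovariant Δ S → ¬ HasNontrivialU4 S →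
    ∀ ε : ℝ, 0 < ε → ∃ p₀ : ℝ, 0 < p₀ ∧ ∀ p : ℝ, 0 < p → p < p₀ → ∃ L₀ : ℕ, ∀ L ≥ L₀,
      gapEff L ⌈p * ((box 3 L).card : ℝ)⌉₊ ≤ ε

/-! ### Registered stubs (the ONLY `sorry`s of this file) -/

/-- STUB A (M, provable now) — `VarianceSplit`: for every `L` and every `P ⊆ Λ_L`,
`Σ_τ (w(τ)/Z)·Var_{Λ∖P}^{τ∨+}(M_L) = R_L(P) − N_L(P)`.
Proof sketch: (i) DLR/consistency of the finite-volume specification — the `τ`-average of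
`isingExpect (Λ∖P) (.fixed (glue Λ τ plus)) f` is `⟨f⟩⁺_Λ` and `pinnedMean`/`pinnedVar` are the
conditional mean/variance of `M_L` given `σ_P` under `μ⁺_Λ` (`isingWeight_fixed_eq_mul`,
`isingExpect_fixed_eq_of_separated`, as in `PlantedPinningCeiling.pinningEfficiencyLeOne_proof`);
(ii) law of total variance `E Var(M|σ_P) = Var M − Var E[M|σ_P]`; (iii) `G_{PP}` is positive definite
(every pattern on `Λ` has positive `μ⁺_Λ`-weight, so no non-trivial affine function of `σ_P` is a.s.
constant), hence `(G_{PP})⁻¹` is a true inverse, `Lin_P` satisfies the normal equations, and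
Pythagoras in `L²(μ⁺_Λ)` gives `Var E[M|σ_P] = C(G_{PP})⁻¹C + E(E[M|σ_P] − Lin_P)²`. -/
theorem stub_varianceSplit :
    ∀ (L : ℕ) (P : Finset (Site 3)), P ⊆ box 3 L →
      ∑ τ : ↥(box 3 L) → ℤˣ, plusProb L τ * pinnedVar L P (glue (box 3 L) τ .plus)
        = linResidual L P - regressionGap L P := by
  sorry

/-- STUB B (L–XL, open but two-point only) — `TwoPointSaturation`: if `criticalCorr 3` has a
non-degenerate Möbius-covariant pointwise scaling limit (so `⟨σ₀σ_x⟩_{β_c} = ‖x‖^{-2Δ+o(1)}`,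
`1 ≤ 2Δ ≤ 1+η-window`, tree `two_point_ratio_asymptotics`), then for every `ε > 0`, for `p` small and
`L ≥ L₀(p)`, `e^{lin}_L(⌈p|Λ_L|⌉) ≥ 1 − ε`.
Why plausibly true: the Gaussian Riccati flow `1/v_{j+1} − 1/v_j = (1+s_j)/(n−j)²` has slack
`s_j = s^{var}_j + s^{CS}_j + s^{Jen}_j` with `s^{var}` = mean linearly-explained single-spin variance
`≲ p·Σ_{|x|≤L*}G(0,x)²/λ_min → 0` (`Σ_{|x|≤R}G² ≍ R^{1−2η}` grows slower than the pin budget),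
`s^{CS}`, `s^{Jen}` = relative fluctuations of `χ_P(z)` over `z` and `P`, which average over the
`≍ p^{1−3/(3−2Δ)} → ∞` pins inside a screening ball (for the GFF kernel: `χ_P(z) ∝ E_z[τ_P]`,
quenched = annealed by the range LLN, `p·E₀τ_P → G(0,0)`). Why it might fail: no random-walk
representation of `G_L⁻¹` is known for Ising (cf. crux `InverseMFerromagnet`), and `λ_min(G_{PP})`
for typical `P` is uncontrolled. Cheapest falsifier: MC two-point matrix at `L = 24–32`, random
Schur complements at `p ∈ {0.01,…,0.05}`: a `p`-flat linear plateau `< 1` kills B (and the line). -/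
theorem stub_twoPointSaturation :
    ∀ (ρ : ℝ → ℝ) (Δ : ℝ) (S : CorrFamily 3), (∀ δ ∈ Set.Ioc (0:ℝ) 1, 0 < ρ δ) → 0 < Δ →
      HasPointwiseScalingLimit (criticalCorr 3) ρ S → IsNondegenerateTwoPoint S →
      IsMoebiusCovariant Δ S →
      ∀ ε : ℝ, 0 < ε → ∃ p₀ : ℝ, 0 < p₀ ∧ ∀ p : ℝ, 0 < p → p < p₀ → ∃ L₀ : ℕ, ∀ L ≥ L₀,
        1 - ε ≤ linEff L ⌈p * ((box 3 L).card : ℝ)⌉₊ := by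
  sorry

/-- STUB C (XL, OPEN, LOAD-BEARING) — `GaussianLinearisesRegression`: under the crux hypotheses
(non-degenerate Möbius pointwise limit `(ρ,Δ,S)` of `criticalCorr 3` with `U₄ ≡ 0` off coincidences),
for every `ε > 0`, for `p` small and `L ≥ L₀(p)`, `e^{gap}_L(⌈p|Λ_L|⌉) ≤ ε`, i.e.
`p·χ_N(p) → 0` where `χ_N` is the "nonlinear regression susceptibility"
`n⁻¹·E⁺(E[M_L|σ_P] − Lin_P)²`: the planted regression is asymptotically linear. Mechanism to prove:
a conditional CLT — vanishing `U₄` of the limit (`U₄` dominates all higher truncations lattice-side: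
`newman_gaussian_evenMoment_le_holds`, `corrIn_le_pairingSum`) forces the regression of a spin at
distance `≍ L*(p) → ∞` from the pins onto the pinned spins to be linear to leading order, uniformly
over typical planted `P`. Why it might fail: conditioning on exact lattice values `σ_x = ±1` is a
lattice-scale operation that pointwise `n`-point limits may not control (the crux's own risk); a
`Δ > 1/2` generalised-free limit has no `±1` lattice model to test against. -/
theorem stub_gaussianLinearisesRegression :
    ∀ (ρ : ℝ → ℝ) (Δ : ℝ) (S : CorrFamily 3), (∀ δ ∈ Set.Ioc (0:ℝ) 1, 0 < ρ δ) → 0 < Δ →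
      HasPointwiseScalingLimit (criticalCorr 3) ρ S → IsNondegenerateTwoPoint S →
      IsMoebiusCovariant Δ S → ¬ HasNontrivialU4 S →
      ∀ ε : ℝ, 0 < ε → ∃ p₀ : ℝ, 0 < p₀ ∧ ∀ p : ℝ, 0 < p → p < p₀ → ∃ L₀ : ℕ, ∀ L ≥ L₀,
        gapEff L ⌈p * ((box 3 L).card : ℝ)⌉₊ ≤ ε := by
  sorry

/-! ### Name-keyed aliases of the stub statements (the hypotheses of the composition)

`Registered.stub_<x>` is (reducibly) the named statement, which is verbatim the signature of the
registered `stub_<x>`; `GaussianPinningSaturation_of_stubs` below witnesses the definitional match. -/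
namespace Registered

/-- Alias of `VarianceSplit` keyed by the registered stub name. -/
abbrev stub_varianceSplit : Prop := VarianceSplit
/-- Alias of `TwoPointSaturation` keyed by the registered stub name. -/
abbrev stub_twoPointSaturation : Prop := TwoPointSaturation
/-- Alias of `GaussianLinearisesRegression` keyed by the registered stub name. -/
abbrev stub_gaussianLinearisesRegression : Prop := GaussianLinearisesRegression

end Registered

/-! ### Sorry-free glue -/

/-- The planted efficiency splits as linear efficiency minus gap efficiency (STUB A summed over the
uniform `k`-subsets and pushed through the linear normalisation). -/
theorem plantedEff_eq_linEff_sub_gapEff (hA : Registered.stub_varianceSplit) (L k : ℕ) :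
    plantedEff L k = linEff L k - gapEff L k := by
  have hnum : (∑ P ∈ (box 3 L).powersetCard k, ∑ τ : ↥(box 3 L) → ℤˣ,
        plusProb L τ * pinnedVar L P (glue (box 3 L) τ .plus))
      = (∑ P ∈ (box 3 L).powersetCard k, linResidual L P)
          - ∑ P ∈ (box 3 L).powersetCard k, regressionGap L P := by
    rw [← Finset.sum_sub_distrib]
    refine Finset.sum_congr rfl fun P hP => ?_
    exact hA L P (Finset.mem_powersetCard.1 hP).1
  unfold plantedEff linEff gapEff effOf plantedVar linVar gapVar
  rw [hnum, sub_div]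
  ring

/-- The crux, unfolded through its `let`-tower, is the saturation statement for `plantedEff`
(definitional). -/
theorem gaussianPinningSaturation_iff :
    Summit.CriticalPhenomena.Ising3DConformalLimit.Theses.PlantedPinning.GaussianPinningSaturation ↔
      ∀ (ρ : ℝ → ℝ) (Δ : ℝ) (S : CorrFamily 3), (∀ δ ∈ Set.Ioc (0:ℝ) 1, 0 < ρ δ) → 0 < Δ →
        HasPointwiseScalingLimit (criticalCorr 3) ρ S → IsNondegenerateTwoPoint S →
        IsMoebiusCovariant Δ S → ¬ HasNontrivialU4 S →
        ∀ ε : ℝ, 0 < ε → ∃ p₀ : ℝ, 0 < p₀ ∧ ∀ p : ℝ, 0 < p → p < p₀ → ∃ L₀ : ℕ, ∀ L ≥ L₀,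
          1 - ε ≤ plantedEff L ⌈p * ((box 3 L).card : ℝ)⌉₊ :=
  Iff.rfl

/-! ### The composition: the three stubs imply the crux BY NAME (real proof, no `sorry`) -/

/-- `GaussianPinningSaturation` from STUBS A, B, C: `e = e^{lin} − e^{gap} ≥ (1 − ε/2) − ε/2` for
`p < min p₁ p₂` and `L ≥ max L₁ L₂`. -/
theorem GaussianPinningSaturation_of (hA : Registered.stub_varianceSplit)
    (hB : Registered.stub_twoPointSaturation) (hC : Registered.stub_gaussianLinearisesRegression) :
    Summit.CriticalPhenomena.Ising3DConformalLimit.Theses.PlantedPinning.GaussianPinningSaturation := by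
  rw [gaussianPinningSaturation_iff]
  intro ρ Δ S hρ hΔ hlim hnd hmob hU4 ε hε
  obtain ⟨p₁, hp₁, h₁⟩ := hB ρ Δ S hρ hΔ hlim hnd hmob (ε / 2) (by linarith)
  obtain ⟨p₂, hp₂, h₂⟩ := hC ρ Δ S hρ hΔ hlim hnd hmob hU4 (ε / 2) (by linarith)
  refine ⟨min p₁ p₂, lt_min hp₁ hp₂, fun p hp hpp => ?_⟩
  obtain ⟨L₁, hL₁⟩ := h₁ p hp (lt_of_lt_of_le hpp (min_le_left _ _))
  obtain ⟨L₂, hL₂⟩ := h₂ p hp (lt_of_lt_of_le hpp (min_le_right _ _))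
  refine ⟨max L₁ L₂, fun L hL => ?_⟩
  have hlin := hL₁ L (le_trans (le_max_left _ _) hL)
  have hgap := hL₂ L (le_trans (le_max_right _ _) hL)
  rw [plantedEff_eq_linEff_sub_gapEff hA]
  linarith

/-- Same composition keyed by the registered stubs: the crux modulo exactly the three `sorry`s. -/
theorem GaussianPinningSaturation_of_stubs :
    Summit.CriticalPhenomena.Ising3DConformalLimit.Theses.PlantedPinning.GaussianPinningSaturation :=
  GaussianPinningSaturation_of stub_varianceSplit stub_twoPointSaturation
    stub_gaussianLinearisesRegression

end Summit.CriticalPhenomena.Ising3DConformalLimit.Cruxes.GaussianPinningSaturation.Birth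

end
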